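import Summits.QuantumFields.YangMills.Theorems.BalabanUVNodesN15KingModelAnalyticDeterminantRealSlice
import Literature.Analysis.Quadrature.KernelDyadicEnclosures
import HarnessLib

/-!
# BalabanUVNodes ∕ N15 — THE KING-MODEL RUNG (PART Ϭ-h): KING's (3.96) AS PRINTED — for a symmetric (Hermitian) `D ≥ 0`: `ln det(I + D) ≤ Σ_{p=1}^{n}(−1)^{p−1}p⁻¹tr D^p` for `n` odd and
# `≥` for `n = 2` (`tr D − ½tr D² ≤ ln det(I+D)`), and `ln det(I + D) ≤ tr D` for every Hermitian `D > −I`; eigenvalue by eigenvalue through the spectral theorem (`det(I+D) = Π(1+λ_i)`,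
# `tr D^p = Σλ_i^p`); applied to King's effective Laplacian expanded about PART Ϫ-l's sharp floor `β♯ = am²∕(a+m²)`: `D♭ = β♯⁻¹Δ_eff(U) − 1 ≥ 0`,
# `N·ln β♯ + tr D♭ − ½tr D♭² ≤ ln det Δ_eff(U) ≤ N·ln β♯ + tr D♭` at every unitary background
# (Track A, DAG node N15 = NE2; FAN-OUT v1.1 §N15 s3 «KING-MODEL RUNG … + what the curved case adds»; count-neutral)

HONEST FRAMING.  Count-neutral (cell `pub-ymgap`, seat `pub-ymgap-dag-n15-e` g53; `--supports stmt-QuantumFields-27247 --as helper` = K3ᴬ, KEY MAP v3).  Finite-dimensional spectral bookkeeping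
over any `RCLike` field; King states (3.96) «for a symmetric operator `D` with `‖D‖ < 1`», alternating in the parity of `n`: typed here for `D ≥ 0` (where the odd∕even alternation holds for every size of
`D`) at all odd `n` and at `n = 2`, plus the universal `n = 1` bound for `D > −I`; the even case `n ≥ 4` and the signed case `−I < D < 0` are NOT typed.  The application is to the model's block-field
operator, NOT to King's `G_k^{1∕2}V_kG_k^{1∕2}` of (3.95); NOT the loop expansion (3.97)–(3.98); NOT a node discharge (N15 of record untouched); nothing continuum ∕ ℝ⁴ ∕ OS ∕ Clay.

THE RESULTS:
* §1 (generic, `D` Hermitian on a finite index type, any `RCLike` field; `λ = ` Mathlib's eigenvalues) `conj_diagonal_pow` (`(UΛU^*)^p = UΛ^pU^*`), ★ `IsHermitian.re_trace_pow_eq_sum` (`Re tr D^p = Σλ_i^p`),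
  ★ `IsHermitian.det_one_add_eq_prod` (`det(1+D) = Π(1+λ_i)`), ★ `IsHermitian.log_re_det_one_add_eq_sum` (all `1+λ_i > 0`: `ln Re det(1+D) = Σ ln(1+λ_i)`), `IsHermitian.re_det_one_add_pos`.
* §2 KING's (3.96): ★★★ **`king396_one`** (`D` Hermitian, every `λ_i > −1`: `ln det(I+D) ≤ tr D`), ★★★ **`king396_odd`** (`D ≥ 0`, `n = 2m+1`: `ln det(I+D) ≤ Σ_{p=1}^{n}(−1)^{p−1}p⁻¹tr D^p` —
  Literature `log_one_add_le_altSum` [AbramowitzStegun1964 4.1.24] on each eigenvalue), ★★★ **`king396_two`** (`D ≥ 0`: `tr D − ½tr D² ≤ ln det(I+D)`; Mathlib `le_log_one_add_of_nonneg` and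
  `x − x²∕2 ≤ 2x∕(x+2)`, the tree's `NicolasK.log_one_add_ge` inlined — preflight `dedup.landed`), ★★ `king396_sandwich_two_three` (`tr D − ½tr D² ≤ ln det(I+D) ≤ tr D − ½tr D² + ⅓tr D³`).
* §3 (unitary `U`; `a, m² > 0`, `c ≥ 0`; nonempty fibre) `posSemidef_floorDefect` (`D♭ = β♯⁻¹Δ_eff(U) − 1 ≥ 0`, PART Ϫ-l), `log_re_det_effLapU_eq_floor_add` (`ln det Δ_eff(U) = N·ln β♯ + ln det(1 + D♭)`),
  ★★★ **`king396_effLapU_floor_sandwich`** (`N·ln β♯ + Re tr D♭ − ½Re tr D♭² ≤ ln det Δ_eff(U) ≤ N·ln β♭ + Re tr D♭` — King's second-order expansion of the block-field vacuum energy about the floor).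
PRIOR TREE ART (by name): Literature `KernelQuadrature.log_one_add_le_altSum` (`KernelDyadicEnclosures`), Ͱ-c (`IsHermitian.re_trace_eq_sum_eigenvalues`, `IsHermitian.re_det_eq_prod_eigenvalues` — pattern), Ϫ-l (`isHermitian_effLapU`,
`re_quadForm_effLapU_ge_sharp`), Ϭ-b (`re_det_effLapU_pos`), Mathlib (`Matrix.IsHermitian.spectral_theorem`, `Unitary.conjStarAlgAut_apply`, `Real.log_le_sub_one_of_pos`, `Real.le_log_one_add_of_nonneg`,
`Matrix.PosSemidef.of_dotProduct_mulVec_nonneg`).  Dedup (rg at filing): basename 0 files; needles `king396_one|king396_odd|king396_two|re_trace_pow_eq_sum|det_one_add_eq_prod|king396_effLapU_floor_sandwich` 0 tree files; `hD` hypotheses are per-theorem binders (no Prop `variable`)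
(the tree's `FischerInequality.one_le_det_one_add` is PRIVATE — its 10-line spectral pattern is re-derived, not importable).  Locators: [King1986] (3.95)–(3.97) p.669, (2.14) p.653, (4.33) p.674; [AbramowitzStegun1964] 4.1.24.
0 `sorry`, 0 `def`.
-/

noncomputable section
open scoped BigOperators ComplexConjugate ComplexOrder Matrix.Norms.L2Operator
open Finset Matrix

namespace Summit.QuantumFields.YangMills.BalabanUVNodes.N15KingModelRung.Analytic

open Literature.MathematicalPhysics.QuantumFieldTheory.Balaban1983to89.B5Prop11Plancherel (Tor fine)
open Literature.Analysis.Quadrature.KernelQuadrature (log_one_add_le_altSum)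
open Summit.QuantumFields.YangMills.BalabanUVNodes.N15KingModelRung.CovariantBlock (BlockTree effLapU)

/-! ## §1 Spectral bookkeeping for `det(1+D)` and `tr D^p` -/

section Spectral

variable {𝕜 : Type*} [RCLike 𝕜] {ι : Type*} [Fintype ι] [DecidableEq ι]

/-- `(UΛV)^p = UΛ^pV` whenever `VU = 1` and `UV = 1`. [folklore] -/
theorem conj_diagonal_pow {U V Λ : Matrix ι ι 𝕜} (hVU : V * U = 1) (hUV : U * V = 1) : ∀ p : ℕ, (U * Λ * V) ^ p = U * Λ ^ p * V
  | 0 => by rw [pow_zero, pow_zero, Matrix.mul_one, hUV]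
  | p + 1 => by
      rw [pow_succ, conj_diagonal_pow hVU hUV p, pow_succ]
      simp only [Matrix.mul_assoc]
      rw [← Matrix.mul_assoc V U, hVU, Matrix.one_mul]

/-- The spectral decomposition with both unitarity relations. [folklore] -/
theorem IsHermitian.spectral_decomposition {D : Matrix ι ι 𝕜} (hD : D.IsHermitian) :
    ∃ U : Matrix ι ι 𝕜, U * Uᴴ = 1 ∧ Uᴴ * U = 1 ∧ D = U * diagonal (RCLike.ofReal ∘ hD.eigenvalues) * Uᴴ := by
  refine ⟨(hD.eigenvectorUnitary : Matrix ι ι 𝕜), ?_, ?_, ?_⟩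
  · rw [← star_eq_conjTranspose]; exact Unitary.coe_mul_star_self _
  · rw [← star_eq_conjTranspose]; exact Unitary.coe_star_mul_self _
  · have h := hD.spectral_theorem
    rwa [Unitary.conjStarAlgAut_apply, star_eq_conjTranspose] at h

/-- ★ `Re tr D^p = Σ_i λ_i^p` for Hermitian `D`. [cite: King1986, (3.96) p.669] -/
theorem IsHermitian.re_trace_pow_eq_sum {D : Matrix ι ι 𝕜} (hD : D.IsHermitian) (p : ℕ) : RCLike.re (D ^ p).trace = ∑ i, hD.eigenvalues i ^ p := by
  obtain ⟨U, hUU, hUU', hsp⟩ := IsHermitian.spectral_decomposition hD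
  have hDp : D ^ p = U * (diagonal (RCLike.ofReal ∘ hD.eigenvalues)) ^ p * Uᴴ := by rw [← conj_diagonal_pow hUU' hUU p, ← hsp]
  rw [hDp, Matrix.trace_mul_cycle, hUU', Matrix.one_mul, diagonal_pow, Matrix.trace_diagonal, map_sum]
  refine Finset.sum_congr rfl fun i _ => ?_
  rw [Pi.pow_apply, Function.comp_apply, ← RCLike.ofReal_pow, RCLike.ofReal_re]

/-- ★ `det(1 + D) = Π_i (1 + λ_i)` for Hermitian `D`. [cite: King1986, (3.96) p.669] -/
theorem IsHermitian.det_one_add_eq_prod {D : Matrix ι ι 𝕜} (hD : D.IsHermitian) : (1 + D).det = ∏ i, ((1 + hD.eigenvalues i : ℝ) : 𝕜) := by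
  obtain ⟨U, hUU, hUU', hsp⟩ := IsHermitian.spectral_decomposition hD
  have h1D : 1 + D = U * diagonal (fun i => ((1 + hD.eigenvalues i : ℝ) : 𝕜)) * Uᴴ := by
    have hdiag : diagonal (fun i => ((1 + hD.eigenvalues i : ℝ) : 𝕜)) = 1 + diagonal (RCLike.ofReal ∘ hD.eigenvalues) := by
      rw [← diagonal_one, diagonal_add]
      congr 1
      funext i
      simp
    rw [hdiag, Matrix.mul_add, Matrix.add_mul, Matrix.mul_one, hUU, ← hsp]
  rw [h1D, Matrix.det_mul, Matrix.det_mul, mul_comm (U.det), mul_assoc, ← Matrix.det_mul, hUU, Matrix.det_one, mul_one, det_diagonal]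

/-- `Re det(1+D) = Π_i (1 + λ_i)`. [cite: King1986, (3.96) p.669] -/
theorem IsHermitian.re_det_one_add_eq_prod {D : Matrix ι ι 𝕜} (hD : D.IsHermitian) : RCLike.re (1 + D).det = ∏ i, (1 + hD.eigenvalues i) := by
  rw [IsHermitian.det_one_add_eq_prod hD, ← RCLike.ofReal_prod, RCLike.ofReal_re]

/-- `0 < Re det(1+D)` when every `1 + λ_i > 0`. [cite: King1986, (3.96) p.669] -/
theorem IsHermitian.re_det_one_add_pos {D : Matrix ι ι 𝕜} (hD : D.IsHermitian) (hpos : ∀ i, 0 < 1 + hD.eigenvalues i) : 0 < RCLike.re (1 + D).det := by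
  rw [IsHermitian.re_det_one_add_eq_prod hD]; exact Finset.prod_pos fun i _ => hpos i

/-- ★ `ln Re det(1+D) = Σ_i ln(1+λ_i)` when every `1 + λ_i > 0`. [cite: King1986, (3.96) p.669] -/
theorem IsHermitian.log_re_det_one_add_eq_sum {D : Matrix ι ι 𝕜} (hD : D.IsHermitian) (hpos : ∀ i, 0 < 1 + hD.eigenvalues i) : Real.log (RCLike.re (1 + D).det) = ∑ i, Real.log (1 + hD.eigenvalues i) := by
  rw [IsHermitian.re_det_one_add_eq_prod hD, Real.log_prod]
  exact fun i _ => (hpos i).ne'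

end Spectral

/-! ## §2 King's (3.96) -/

section King396

variable {𝕜 : Type*} [RCLike 𝕜] {ι : Type*} [Fintype ι] [DecidableEq ι] {D : Matrix ι ι 𝕜}

/-- ★★★ **KING's (3.96) AT `n = 1` FOR EVERY `D > −I`**: Hermitian `D` with all `1 + λ_i > 0` has `ln det(I + D) ≤ tr D` (`ln(1+x) ≤ x`). [cite: King1986, (3.96) p.669] -/
theorem king396_one (hD : D.IsHermitian) (hpos : ∀ i, 0 < 1 + hD.eigenvalues i) : Real.log (RCLike.re (1 + D).det) ≤ RCLike.re D.trace := by
  rw [IsHermitian.log_re_det_one_add_eq_sum hD hpos, Covariant.IsHermitian.re_trace_eq_sum_eigenvalues hD]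
  refine Finset.sum_le_sum fun i _ => ?_
  have := Real.log_le_sub_one_of_pos (hpos i)
  linarith

/-- Eigenvalues of a positive semidefinite matrix have `1 + λ_i > 0`. [folklore] -/
theorem one_add_eigenvalues_pos (hD : D.PosSemidef) (i : ι) : 0 < 1 + hD.1.eigenvalues i := by
  have := hD.eigenvalues_nonneg i; linarith

/-- ★★★ **KING's (3.96), `n` ODD**: `D ≥ 0` symmetric ⟹ `ln det(I + D) ≤ Σ_{p=1}^{n}(−1)^{p−1}p⁻¹·tr D^p` for `n = 2m+1` — the odd alternating partial sums of `ln(1+λ)` are upper bounds, eigenvalue by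
eigenvalue. [cite: King1986, (3.96) p.669; AbramowitzStegun1964, 4.1.24] -/
theorem king396_odd (hD : D.PosSemidef) (m : ℕ) :
    Real.log (RCLike.re (1 + D).det) ≤ ∑ k ∈ Finset.range (2 * m + 1), (-1) ^ k * RCLike.re (D ^ (k + 1)).trace / (k + 1) := by
  rw [IsHermitian.log_re_det_one_add_eq_sum hD.1 (one_add_eigenvalues_pos hD)]
  simp_rw [IsHermitian.re_trace_pow_eq_sum hD.1, Finset.mul_sum, Finset.sum_div]
  rw [Finset.sum_comm]
  exact Finset.sum_le_sum fun i _ => log_one_add_le_altSum (hD.eigenvalues_nonneg i) m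

/-- ★★★ **KING's (3.96), `n = 2`**: `D ≥ 0` symmetric ⟹ `tr D − ½tr D² ≤ ln det(I + D)`. [cite: King1986, (3.96) p.669] -/
theorem king396_two (hD : D.PosSemidef) : RCLike.re D.trace - RCLike.re (D ^ 2).trace / 2 ≤ Real.log (RCLike.re (1 + D).det) := by
  rw [IsHermitian.log_re_det_one_add_eq_sum hD.1 (one_add_eigenvalues_pos hD), Covariant.IsHermitian.re_trace_eq_sum_eigenvalues hD.1,
    IsHermitian.re_trace_pow_eq_sum hD.1 2, Finset.sum_div, ← Finset.sum_sub_distrib]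
  refine Finset.sum_le_sum fun i _ => ?_
  -- `x − x²∕2 ≤ 2x∕(x+2) ≤ ln(1+x)` for `x ≥ 0` (the tree's `NicolasK.log_one_add_ge`, inlined to keep the import closure light)
  have hx := hD.eigenvalues_nonneg i
  refine le_trans ?_ (Real.le_log_one_add_of_nonneg hx)
  rw [le_div_iff₀ (by linarith)]
  nlinarith [sq_nonneg (hD.1.eigenvalues i), mul_nonneg hx (sq_nonneg (hD.1.eigenvalues i))]

/-- ★★ **THE `n = 2 ∕ n = 3` SANDWICH**: `D ≥ 0` ⟹ `tr D − ½tr D² ≤ ln det(I+D) ≤ tr D − ½tr D² + ⅓tr D³`. [cite: King1986, (3.96) p.669] -/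
theorem king396_sandwich_two_three (hD : D.PosSemidef) :
    RCLike.re D.trace - RCLike.re (D ^ 2).trace / 2 ≤ Real.log (RCLike.re (1 + D).det)
      ∧ Real.log (RCLike.re (1 + D).det) ≤ RCLike.re D.trace - RCLike.re (D ^ 2).trace / 2 + RCLike.re (D ^ 3).trace / 3 := by
  refine ⟨king396_two hD, ?_⟩
  have h := king396_odd hD 1
  simp only [show 2 * 1 + 1 = 3 from rfl, Finset.sum_range_succ, Finset.sum_range_zero, zero_add, pow_zero, one_mul, pow_one] at h
  norm_num at h
  linarith

end King396

/-! ## §3 King's expansion of the block-field vacuum energy about the sharp floor -/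

section Model

variable {d : ℕ} {L : ℕ} [NeZero L] (T : BlockTree d L) (M : Fin (d + 1) → ℕ) [hM : ∀ μ, NeZero (M μ)]
variable {𝕜 : Type*} [RCLike 𝕜] {n : Type*} [Fintype n] [DecidableEq n]
variable {a c m2 : ℝ} (ha : 0 < a) (hc : 0 ≤ c) (hm : 0 < m2) {U : Tor (fine L M) × Fin (d + 1) → Matrix n n 𝕜} (hU : ∀ bd, U bd ∈ Matrix.unitaryGroup n 𝕜)
include ha hc hm hU

/-- `D♭ = (a⁻¹+m⁻²)·Δ_eff(U) − 1` is Hermitian. [cite: King1986, (2.14) p.653] -/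
theorem isHermitian_floorDefect : ((((a⁻¹ + m2⁻¹ : ℝ)) : 𝕜) • effLapU T M a c m2 U - 1).IsHermitian := by
  refine Matrix.IsHermitian.sub ?_ Matrix.isHermitian_one
  rw [Matrix.IsHermitian, Matrix.conjTranspose_smul, (isHermitian_effLapU T M ha hc hm hU).eq, RCLike.star_def, RCLike.conj_ofReal]

/-- `D♭ = β♯⁻¹·Δ_eff(U) − 1` IS POSITIVE SEMIDEFINITE (`β♯ = (a⁻¹+m⁻²)⁻¹`, PART Ϫ-l's sharp floor). [cite: King1986, (2.14) p.653, (4.33) p.674] -/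
theorem posSemidef_floorDefect [Nonempty n] : ((((a⁻¹ + m2⁻¹ : ℝ)) : 𝕜) • effLapU T M a c m2 U - 1).PosSemidef := by
  have hH' := isHermitian_floorDefect T M ha hc hm hU
  refine Matrix.PosSemidef.of_dotProduct_mulVec_nonneg hH' fun g => ?_
  have hre : RCLike.re (star g ⬝ᵥ (((((a⁻¹ + m2⁻¹ : ℝ)) : 𝕜) • effLapU T M a c m2 U - 1) *ᵥ g))
      = (a⁻¹ + m2⁻¹) * RCLike.re (star g ⬝ᵥ (effLapU T M a c m2 U *ᵥ g)) - ∑ p, ‖g p‖ ^ 2 := by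
    rw [Matrix.sub_mulVec, Matrix.smul_mulVec, Matrix.one_mulVec, dotProduct_sub, dotProduct_smul, map_sub, smul_eq_mul, RCLike.re_ofReal_mul,
      Literature.LinearAlgebra.Matrix.RayleighQuotient.re_star_dotProduct_self]
  have hfloor := re_quadForm_effLapU_ge_sharp T M ha hc hm hU g
  have hs : 0 < a⁻¹ + m2⁻¹ := by positivity
  have hge : ∑ p, ‖g p‖ ^ 2 ≤ (a⁻¹ + m2⁻¹) * RCLike.re (star g ⬝ᵥ (effLapU T M a c m2 U *ᵥ g)) := by
    have := mul_le_mul_of_nonneg_left hfloor hs.le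
    rwa [← mul_assoc, mul_inv_cancel₀ hs.ne', one_mul] at this
  exact RCLike.nonneg_iff.mpr ⟨by rw [hre]; linarith, hH'.im_star_dotProduct_mulVec_self g⟩

/-- `ln det Δ_eff(U) = N·ln β♯ + ln det(1 + D♭)` (`1 + D♭ = β♯⁻¹Δ_eff(U)`). [cite: King1986, (2.14) p.653, (3.95)–(3.96) p.669] -/
theorem log_re_det_effLapU_eq_floor_add :
    Real.log (RCLike.re (effLapU T M a c m2 U).det)
      = Fintype.card (Tor M × n) * Real.log ((a⁻¹ + m2⁻¹)⁻¹) + Real.log (RCLike.re (1 + ((((a⁻¹ + m2⁻¹ : ℝ)) : 𝕜) • effLapU T M a c m2 U - 1)).det) := by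
  have hs : 0 < a⁻¹ + m2⁻¹ := by positivity
  have hΔ := re_det_effLapU_pos T M ha hc hm hU
  rw [add_sub_cancel, Matrix.det_smul, ← RCLike.ofReal_pow, RCLike.re_ofReal_mul, Real.log_mul (pow_pos hs _).ne' hΔ.ne', Real.log_pow, Real.log_inv]
  ring

/-- ★★★ **KING's SECOND-ORDER EXPANSION OF THE BLOCK-FIELD VACUUM ENERGY ABOUT THE SHARP FLOOR**: with `D♭ = β♯⁻¹Δ_eff(U) − 1 ≥ 0` (`β♯ = (a⁻¹+m⁻²)⁻¹`),
`N·ln β♯ + Re tr D♭ − ½Re tr D♭² ≤ ln det Δ_eff(U) ≤ N·ln β♯ + Re tr D♭` at every unitary background ((3.96) at `n = 2` and `n = 1`). [cite: King1986, (3.95)–(3.96) p.669, (2.14) p.653, (4.33) p.674] -/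
theorem king396_effLapU_floor_sandwich [Nonempty n] {Df : Matrix (Tor M × n) (Tor M × n) 𝕜} (hDf : Df = (((a⁻¹ + m2⁻¹ : ℝ)) : 𝕜) • effLapU T M a c m2 U - 1) :
    Fintype.card (Tor M × n) * Real.log ((a⁻¹ + m2⁻¹)⁻¹) + (RCLike.re Df.trace - RCLike.re (Df ^ 2).trace / 2) ≤ Real.log (RCLike.re (effLapU T M a c m2 U).det)
      ∧ Real.log (RCLike.re (effLapU T M a c m2 U).det) ≤ Fintype.card (Tor M × n) * Real.log ((a⁻¹ + m2⁻¹)⁻¹) + RCLike.re Df.trace := by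
  have hPSD := posSemidef_floorDefect T M ha hc hm hU
  rw [← hDf] at hPSD
  have h2 := king396_two hPSD
  have h1 := king396_one hPSD.1 (one_add_eigenvalues_pos hPSD)
  rw [log_re_det_effLapU_eq_floor_add T M ha hc hm hU, ← hDf]
  constructor <;> linarith

end Model

end Summit.QuantumFields.YangMills.BalabanUVNodes.N15KingModelRung.Analytic

end
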